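import Literature.MathematicalPhysics.QuantumLattice.PeriodicSublatticeAndStaggeredTerms
import Literature.MathematicalPhysics.QuantumLattice.InfVolFermionStateSpinFlip
import HarnessLib

/-!
# Spin-exchange symmetry of lattice-fermion pressures; the bound on spontaneous staggered
# magnetisation of the Hubbard model by the pressure response to a staggered field

The spin exchange `(x,σ) ↦ (x,σ̄)` is second-quantised in the tree on every local algebra (`relabel Orb.spinSwap`,
`FermionRelabelling`; `partitionFn_relabel`). Here it is lifted to INTERACTIONS and to the thermodynamic-limit pressures:

* §1 (tree) naturality: spin exchange commutes with every isotony / translation map `Γ(φ)` and with the grading `Θ`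
  (`fermionEmbed_relabel_spinSwap`, `relabel_parityAut` of `InfVolFermionStateSpinFlip`).
* §2 the spin-flipped interaction `Ψ.spinFlip` (`Φ X ↦ Γ_swap(Φ X)`): its local Hamiltonians are the spin-exchanged ones, so
  **all box partition functions agree** (`partitionFn_spinFlip_localHamiltonian`); Hermitian / even / finite range / translation
  covariant / `q`-periodic are preserved.
* §3 **THE PRESSURES ARE SPIN-EXCHANGE INVARIANT**: `P_q(β, Ψ.spinFlip) = P_q(β, Ψ)` for every periodic Hermitian even finite-range
  `Ψ` and every real `β` (`perVarPressure_spinFlip`, both sides being the limit of the same aligned-box pressures by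
  `tendsto_boxLogPartitionFn_perVarPressure`), and `P(β, Ψ.spinFlip) = P(β, Ψ)` for translation-covariant `Ψ` (`varPressure_spinFlip`).
* §4 the atoms: the Hubbard interaction (tree: `relabel_spinSwap_hubbardΦ`) and the number interaction are spin-exchange invariant, the staggered spin term is ODD
  (`relabel_spinSwap_staggeredSpinInteraction`), hence `(hubbardStaggered d t U θ).spinFlip = hubbardStaggered d t U (θ₀, −θ₁)` and
  **`P(β; μ, −h_s) = P(β; μ, h_s)`** (`perVarPressure_hubbardStaggered_neg`).
* §5 **THE BOUND ON SPONTANEOUS STAGGERED ORDER**: for EVERY `(2ℤ)^d`-periodic equilibrium state `ω` of the Hubbard model at `h_s = 0`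
  (inverse temperature `β > 0`, any `t, U, μ`, `d ≥ 1`) and every `δ > 0`,
  `|m_s(ω)| ≤ (P(β; μ, h_s = −δ… ) − P(β; μ, 0))/(βδ)` — in the tree's coupling convention `θ = (−μ, −h_s)`:
  `|m_s(ω)| ≤ (P_q(θ + δe₁) − P_q(θ))/(βδ)` (`IsPerVarEquilibrium.abs_staggeredMagnetisation_le`), and its certified form from two numbers
  `L₀ ≤ P_q(θ)`, `P_q(θ + δe₁) ≤ U₊` (`…_of_bounds`) — numbers which `abs_perVarPressure_hubbardStaggered_sub_le` produces from even-box
  partition functions. Symmetry-broken (antiferromagnetically ordered) periodic equilibrium states, if any, are covered: the statement is about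
  ALL periodic maximisers of the symmetric model.

Everything is PROVED; definition with body: `FermionInteraction.spinFlip`. No named fact, no number.
HONEST SCOPE: no claim about the existence or absence of staggered order; `(2ℤ)^d`-periodic states only (longer periods reduce to these for
the pressure by `PeriodicPressureSuperlatticeIndependence`, not restated here).

## Tree / Mathlib search

REUSED: `relabel`, `relabel_conjTranspose`, `partitionFn_relabel`, `Orb.spinSwap` (`FermionRelabelling`); `fermionEmbed_relabel_spinSwap`,
`relabel_parityAut`, `relabel_spinSwap_nAt`, `relabel_spinSwap_hubbardΦ` (`InfVolFermionStateSpinFlip`); `localHamiltonian` (`InfVolFermionState`); `numberInteraction` (`TIGroundEnergyDensityResponse`);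
`staggeredSpinInteraction`, `hubbardStaggered(_structure)`, `staggeredMagnetisation`, `IsPerVarEquilibrium.staggeredMagnetisation_mem_Icc`
(`PeriodicSublatticeAndStaggeredTerms`); `tendsto_boxLogPartitionFn_perVarPressure` (`PeriodicGibbsVariationalPrinciple`); `perVarPressure_eq_varPressure`
(`PeriodicVariationalPressure`). `lean search 'spinFlip|spin exchange pressure|staggered magnetisation bound'` (2026-08-28): finite-volume only.

## References

* R. B. Griffiths, *A proof that the free energy of a spin system is extensive*, J. Math. Phys. 5 (1964) 1215, Eq. (39) and Fig. 3.
* R. B. Israel, *Convexity in the Theory of Lattice Gases* (1979), Thm. I.2.4, §IV.2 (symmetries and symmetry breaking).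
* G. Benfatto, A. Giuliani, V. Mastropietro, Ann. Henri Poincaré 7 (2006) 809, §2.1 (symmetries of the Hubbard model: spin exchange).
* O. Bratteli, D. W. Robinson, *OAQSM 2* (1997), §5.2.2, Thm. 5.2.5 (Bogoliubov transformations).
-/

noncomputable section

open scoped ComplexOrder BigOperators
open Finset Filter Topology

namespace Literature.MathematicalPhysics.QuantumLattice

open Matrix HubbardWave0 Literature.Probability.LatticeModels ThermodynamicLimit

variable {d : ℕ}

/-! ### §1. (Naturality of the spin exchange — `fermionEmbed_relabel_spinSwap`, `relabel_parityAut` — and the state-level flip are in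
`InfVolFermionStateSpinFlip`; this file lifts the symmetry to interactions and pressures.) -/

/-! ### §2. The spin-flipped interaction -/

namespace FermionInteraction

/-- **The spin-flipped interaction** `Ψ^swap`: `Φ^swap X = Γ_swap(Φ X)` (exchange `↑ ↔ ↓` in every term).
[cite: BenfattoGiulianiMastropietro2006, §2.1 (symmetry (1), spin exchange)] -/
def spinFlip (Ψ : FermionInteraction d) : FermionInteraction d where
  Φ X := relabel (Orb.spinSwap : Orb (PolySite X) ≃ Orb (PolySite X)) (Ψ.Φ X)

variable (Ψ : FermionInteraction d)

/-- The terms of `Ψ^swap` (definitional). [cite: BenfattoGiulianiMastropietro2006, §2.1] -/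
theorem spinFlip_apply (X : Finset (Site d)) :
    Ψ.spinFlip.Φ X = relabel (Orb.spinSwap : Orb (PolySite X) ≃ Orb (PolySite X)) (Ψ.Φ X) := rfl

/-- **The local Hamiltonians of `Ψ^swap` are the spin-exchanged local Hamiltonians.** [cite: BenfattoGiulianiMastropietro2006, §2.1] -/
theorem spinFlip_localHamiltonian (Λ : Finset (Site d)) :
    Ψ.spinFlip.localHamiltonian Λ = relabel (Orb.spinSwap : Orb (PolySite Λ) ≃ Orb (PolySite Λ)) (Ψ.localHamiltonian Λ) := by
  unfold localHamiltonian
  rw [map_sum]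
  exact Finset.sum_congr rfl fun X _ => fermionEmbed_relabel_spinSwap _ _

/-- **All box partition functions are spin-exchange invariant**: `Tr e^{−βH_Λ(Ψ^swap)} = Tr e^{−βH_Λ(Ψ)}`.
[cite: BenfattoGiulianiMastropietro2006, §2.1 (symmetry (1), spin exchange)] -/
theorem partitionFn_spinFlip_localHamiltonian (β : ℝ) (Λ : Finset (Site d)) :
    Matrix.partitionFn β (Ψ.spinFlip.localHamiltonian Λ) = Matrix.partitionFn β (Ψ.localHamiltonian Λ) := by
  rw [spinFlip_localHamiltonian, partitionFn_relabel]

variable {Ψ} {R : ℝ} {q : Fin d → ℕ}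

/-- `Ψ^swap` is Hermitian if `Ψ` is. [cite: ArakiMoriya2003, §1 assumption (II)] -/
theorem IsHermitian.spinFlip (h : Ψ.IsHermitian) : Ψ.spinFlip.IsHermitian := fun X => by
  unfold Matrix.IsHermitian
  rw [spinFlip_apply, ← relabel_conjTranspose, (h X).eq]

/-- `Ψ^swap` is even if `Ψ` is. [cite: ArakiMoriya2003, §1 assumption (II)] -/
theorem IsEven.spinFlip (h : Ψ.IsEven) : Ψ.spinFlip.IsEven := fun X => by
  rw [spinFlip_apply, ← relabel_parityAut, h X]

/-- `Ψ^swap` has the range of `Ψ`. [cite: ArakiMoriya2003, §5.4] -/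
theorem HasFiniteRange.spinFlip (h : Ψ.HasFiniteRange R) : Ψ.spinFlip.HasFiniteRange R := fun X hX => by
  rw [spinFlip_apply, h X hX, map_zero]

/-- `Ψ^swap` is translation covariant if `Ψ` is. [cite: ArakiMoriya2003, §1 assumption (IV)] -/
theorem IsTranslationInvariant.spinFlip (h : Ψ.IsTranslationInvariant) : Ψ.spinFlip.IsTranslationInvariant := fun v X => by
  rw [spinFlip_apply, spinFlip_apply, h v X, fermionEmbed_relabel_spinSwap]

/-- `Ψ^swap` is `q`-periodic if `Ψ` is. [cite: ArakiMoriya2003, §1 assumption (IV) and §8] -/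
theorem IsPeriodic.spinFlip (h : Ψ.IsPeriodic q) : Ψ.spinFlip.IsPeriodic q := fun z X => by
  rw [spinFlip_apply, spinFlip_apply, h z X, fermionEmbed_relabel_spinSwap]

/-! ### §3. The pressures are spin-exchange invariant -/

/-- **`P_q(β, Ψ^swap) = P_q(β, Ψ)`** for every `q`-periodic Hermitian even finite-range `Ψ`, every real `β` (`d ≥ 1`): both are the limit of
the same aligned-box pressures. [cite: Israel1979, Thm. I.2.4] [cite: BenfattoGiulianiMastropietro2006, §2.1] -/
theorem perVarPressure_spinFlip (hd : 0 < d) (hH : Ψ.IsHermitian) (hE : Ψ.IsEven) (hΨ : Ψ.IsPeriodic q) (hR : Ψ.HasFiniteRange R)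
    (β : ℝ) : Ψ.spinFlip.perVarPressure β q R = Ψ.perVarPressure β q R := by
  have h1 := tendsto_boxLogPartitionFn_perVarPressure hd hH.spinFlip hE.spinFlip hΨ.spinFlip hR.spinFlip β
  have h2 := tendsto_boxLogPartitionFn_perVarPressure hd hH hE hΨ hR β
  simp only [partitionFn_spinFlip_localHamiltonian] at h1
  exact tendsto_nhds_unique h1 h2

/-- **`P(β, Ψ^swap) = P(β, Ψ)`** for translation-covariant `Ψ` (the translation-invariant variational pressure).
[cite: Israel1979, Thm. I.2.4] [cite: BenfattoGiulianiMastropietro2006, §2.1] -/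
theorem varPressure_spinFlip (hd : 0 < d) (hH : Ψ.IsHermitian) (hE : Ψ.IsEven) (hT : Ψ.IsTranslationInvariant)
    (hR : Ψ.HasFiniteRange R) (β : ℝ) : Ψ.spinFlip.varPressure β R = Ψ.varPressure β R := by
  rw [← perVarPressure_eq_varPressure hd β (fun _ => 0) hT R, ← perVarPressure_eq_varPressure hd β (fun _ => 0) hT.spinFlip R]
  exact perVarPressure_spinFlip hd hH hE (hT.isPeriodic _) hR β

end FermionInteraction

/-! ### §4. The atoms under spin exchange; the staggered-field Hubbard model -/

/-- **The number interaction is spin-exchange invariant.** [cite: BenfattoGiulianiMastropietro2006, §2.1] -/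
theorem relabel_spinSwap_numberInteraction (X : Finset (Site d)) :
    relabel (Orb.spinSwap : Orb (PolySite X) ≃ Orb (PolySite X)) ((numberInteraction d).Φ X) = (numberInteraction d).Φ X := by
  have hn : ∀ (x : Site d) (hx : x ∈ X), nAt x hx 1 + nAt x hx 0 = nAt x hx 0 + nAt x hx 1 := fun x hx => add_comm _ _
  simp only [numberInteraction, map_sum, apply_ite (relabel (Orb.spinSwap : Orb (PolySite X) ≃ Orb (PolySite X))), map_zero, map_add,
    InfVolFermionState.relabel_spinSwap_nAt, Equiv.swap_apply_left, Equiv.swap_apply_right, hn]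

/-- **The staggered spin term is ODD under spin exchange**: `Γ_swap(Φ_stag X) = −Φ_stag X`. [cite: BenfattoGiulianiMastropietro2006, §2.1] -/
theorem relabel_spinSwap_staggeredSpinInteraction (X : Finset (Site d)) :
    relabel (Orb.spinSwap : Orb (PolySite X) ≃ Orb (PolySite X)) ((staggeredSpinInteraction d).Φ X) = -(staggeredSpinInteraction d).Φ X := by
  have hn : ∀ (x : Site d) (hx : x ∈ X) (s : ℂ), s • (nAt x hx 1 - nAt x hx 0) = -(s • (nAt x hx 0 - nAt x hx 1)) := by
    intro x hx s
    rw [← smul_neg, neg_sub]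
  simp only [staggeredSpinInteraction, map_sum, apply_ite (relabel (Orb.spinSwap : Orb (PolySite X) ≃ Orb (PolySite X))), map_zero,
    map_smul, map_sub, InfVolFermionState.relabel_spinSwap_nAt, Equiv.swap_apply_left, Equiv.swap_apply_right, hn, ← Finset.sum_neg_distrib,
    neg_ite, neg_zero]

/-- **Spin exchange reverses the staggered field**: `(Ψ^{t,U}(θ₀, θ₁))^swap = Ψ^{t,U}(θ₀, −θ₁)`. [cite: BenfattoGiulianiMastropietro2006, §2.1] -/
theorem spinFlip_hubbardStaggered (t U : ℝ) (θ : Fin 2 → ℝ) :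
    (hubbardStaggered d t U θ).spinFlip = hubbardStaggered d t U ![θ 0, -θ 1] := by
  refine FermionInteraction.ext fun X => ?_
  rw [FermionInteraction.spinFlip_apply, hubbardStaggered, hubbardStaggered, FermionInteraction.linearFamily_apply,
    FermionInteraction.linearFamily_apply, Fin.sum_univ_two, Fin.sum_univ_two, map_add, map_add, map_smul, map_smul]
  simp only [Matrix.cons_val_zero, Matrix.cons_val_one]
  rw [InfVolFermionState.relabel_spinSwap_hubbardΦ, relabel_spinSwap_numberInteraction, relabel_spinSwap_staggeredSpinInteraction,
    Complex.ofReal_neg, neg_smul, smul_neg]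

/-- **THE PRESSURE IS EVEN IN THE STAGGERED FIELD**: `P(β; θ₀, −θ₁) = P(β; θ₀, θ₁)` (every real `β`, `d ≥ 1`, range parameter `R ≥ 1`).
[cite: Israel1979, Thm. I.2.4] [cite: BenfattoGiulianiMastropietro2006, §2.1] -/
theorem perVarPressure_hubbardStaggered_neg (hd : 0 < d) (t U a b β : ℝ) {R : ℝ} (hR : 1 ≤ R) :
    (hubbardStaggered d t U ![a, -b]).perVarPressure β (evenPeriods d) R = (hubbardStaggered d t U ![a, b]).perVarPressure β (evenPeriods d) R := by
  obtain ⟨hH, hE, hP, hR1⟩ := hubbardStaggered_structure (d := d) t U ![a, b]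
  have hRR : (hubbardStaggered d t U ![a, b]).HasFiniteRange R := fun X hX => hR1 X (lt_of_le_of_lt hR hX)
  have h := FermionInteraction.perVarPressure_spinFlip hd hH hE hP hRR β
  rw [spinFlip_hubbardStaggered] at h
  simpa only [Matrix.cons_val_zero, Matrix.cons_val_one] using h

/-! ### §5. The bound on spontaneous staggered magnetisation -/

namespace InfVolFermionState

variable {β t U a R : ℝ} {ω : InfVolFermionState d}

/-- **BOUND ON SPONTANEOUS STAGGERED ORDER**: for every `(2ℤ)^d`-periodic equilibrium state `ω` of the Hubbard model WITHOUT staggered field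
(`θ = (a, 0)`, `a = −μ`; `β > 0`, `R ≥ 1`, `d ≥ 1`) and every `δ > 0`:
`|m_s(ω)| ≤ (P_q(β; a, δ) − P_q(β; a, 0))/(βδ)` — the Griffiths window made symmetric by spin-exchange invariance of the pressure.
[cite: Griffiths1964, Eq. (39) and Fig. 3] [cite: Israel1979, Thm. I.2.4] -/
theorem IsPerVarEquilibrium.abs_staggeredMagnetisation_le (hd : 0 < d) (hβ : 0 < β) (hR : 1 ≤ R)
    (h : ω.IsPerVarEquilibrium β (evenPeriods d) (hubbardStaggered d t U ![a, 0]) R) {δ : ℝ} (hδ : 0 < δ) :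
    |ω.staggeredMagnetisation| ≤
      ((hubbardStaggered d t U ![a, δ]).perVarPressure β (evenPeriods d) R -
          (hubbardStaggered d t U ![a, 0]).perVarPressure β (evenPeriods d) R) / (β * δ) := by
  have hw := h.staggeredMagnetisation_mem_Icc hβ hδ
  have e1 : (![a, 0] : Fin 2 → ℝ) + Pi.single 1 δ = ![a, δ] := by
    funext i
    fin_cases i <;> simp
  have e2 : (![a, 0] : Fin 2 → ℝ) + Pi.single 1 (-δ) = ![a, -δ] := by
    funext i
    fin_cases i <;> simp
  rw [e1, e2, perVarPressure_hubbardStaggered_neg hd t U a δ β hR] at hw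
  rw [abs_le, ← neg_div, neg_sub]
  exact ⟨hw.1, hw.2⟩

/-- **Certified form**: with numbers `L₀ ≤ P_q(β; a, 0)` and `P_q(β; a, δ) ≤ U₊` (e.g. from even-box partition functions by
`abs_perVarPressure_hubbardStaggered_sub_le`), `|m_s(ω)| ≤ (U₊ − L₀)/(βδ)` for every such equilibrium state.
[cite: Griffiths1964, Eq. (39) and Fig. 3] -/
theorem IsPerVarEquilibrium.abs_staggeredMagnetisation_le_of_bounds (hd : 0 < d) (hβ : 0 < β) (hR : 1 ≤ R)
    (h : ω.IsPerVarEquilibrium β (evenPeriods d) (hubbardStaggered d t U ![a, 0]) R) {δ : ℝ} (hδ : 0 < δ) {L₀ Uplus : ℝ}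
    (hL : L₀ ≤ (hubbardStaggered d t U ![a, 0]).perVarPressure β (evenPeriods d) R)
    (hU : (hubbardStaggered d t U ![a, δ]).perVarPressure β (evenPeriods d) R ≤ Uplus) :
    |ω.staggeredMagnetisation| ≤ (Uplus - L₀) / (β * δ) :=
  (h.abs_staggeredMagnetisation_le hd hβ hR hδ).trans (div_le_div_of_nonneg_right (by linarith) (mul_pos hβ hδ).le)

end InfVolFermionState

end Literature.MathematicalPhysics.QuantumLattice

end
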